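import Literature.Analysis.FluidPDE.ElgindiSinRpowIntegral
import Literature.Analysis.FluidPDE.ElgindiThetaDerivativeOperator
import HarnessLib

/-!
# Trigonometric coefficient functions and the iterated angular derivatives `D_θ^iΓ`
([Elgindi2021] §6.3 / [ElgindiGhoulMasmoudi2021] §3.1: the factors `D_θ^kΓ` of the non-local terms)

Topic `Literature/Analysis/FluidPDE`. Support file (one inductive predicate, everything proved; no
named facts) on the proof path of the named fact
`Literature.Analysis.FluidPDE.Elgindi.ElgindiGhoulMasmoudi2021_stabilityCore`
(`ElgindiStabilityDecomposition.lean`). In the `𝓗ᵏ` coercivity inductions of T. M. Elgindi,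
Ann. of Math. 194 (2021) = arXiv:1904.04795, §6.3 (proof of Proposition 6.13) and of
Elgindi–Ghoul–Masmoudi, arXiv:1910.14071, §3.1 (proof of Proposition 3.2:
"`D_θ^k𝓛^T_{F_*}(f) = 𝓛(D_θ^kf) + D_θ^kΓ(−(2y/(c(1+y)²))L₁₂(f) + (1/c)(2y²/(1+y)³)L₁₂(…)(0)) −
(3/(1+y))sin(2θ)∂_θD_θ^kf`"), the angular derivatives fall on the profile `Γ = (sin θcos²θ)^{α/3}`
only. This file controls them uniformly in `0 ≤ α ≤ 1`:

* `IsTrig₂`: the algebra of functions of `(α, θ)` generated by constants, `α`, `sin θ`, `cos θ`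
  (closed under `D_θ = sin(2θ)∂_θ`, bounded on `[0,1] × ℝ`, smooth in `θ`);
* `D_θ^{i+1}Γ_α = α·U_i(α,θ)·Γ_α` on the open quarter with `U_i ∈ IsTrig₂`
  (`U_0 = (2/3)(1 − 3sin²θ)`), hence `|D_θ^{i+1}Γ_α| ≤ C_iαΓ_α`;
* the angular integrals of the coercivity estimates, uniformly in `α`:
  `∫₀^{π/2}(D_θ^iΓ)²sin(2θ)^{−η} ≤ C_i`, `∫₀^{π/2}(D_θ^iΓ)² ≤ C_i` (`0 ≤ α ≤ 1`), and the singular one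
  `∫₀^{π/2}(D_θ^{i+1}Γ)²sin(2θ)^{−γ} ≤ C_iα` for `0 < α ≤ 1` (`γ = 1 + α/10`; `Γ²sin(2θ)^{−γ}` has
  integral `O(1/α)`, Jordan's inequality on both halves of the quarter as in
  `ElgindiAngularSingularIntegral.lean`).
-/

noncomputable section

open MeasureTheory Set Function Real Filter
open _root_.Topology

namespace Literature.Analysis.FluidPDE

namespace Elgindi

/-! ### Trigonometric coefficient functions -/

/-- The algebra of **trigonometric coefficient functions** of `(α, θ)`: generated by real constants,
the parameter `α`, `sin θ` and `cos θ` under sums and products (the shape of the factors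
`D_θ^iΓ/(αΓ)`). [folklore] -/
inductive IsTrig₂ : (ℝ → ℝ → ℝ) → Prop
  | const (c : ℝ) : IsTrig₂ fun _ _ => c
  | alpha : IsTrig₂ fun α _ => α
  | sin : IsTrig₂ fun _ θ => Real.sin θ
  | cos : IsTrig₂ fun _ θ => Real.cos θ
  | add {f g : ℝ → ℝ → ℝ} : IsTrig₂ f → IsTrig₂ g → IsTrig₂ fun α θ => f α θ + g α θ
  | mul {f g : ℝ → ℝ → ℝ} : IsTrig₂ f → IsTrig₂ g → IsTrig₂ fun α θ => f α θ * g α θ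

namespace IsTrig₂

/-- Scalar multiples. [folklore] -/
theorem const_mul {f : ℝ → ℝ → ℝ} (h : IsTrig₂ f) (c : ℝ) : IsTrig₂ fun α θ => c * f α θ :=
  (const c).mul h

/-- Negatives. [folklore] -/
theorem neg {f : ℝ → ℝ → ℝ} (h : IsTrig₂ f) : IsTrig₂ fun α θ => -f α θ := by
  have e : (fun α θ => -f α θ) = fun α θ => (-1) * f α θ := by funext α θ; ring
  rw [e]; exact h.const_mul (-1)

/-- Differences. [folklore] -/
theorem sub {f g : ℝ → ℝ → ℝ} (hf : IsTrig₂ f) (hg : IsTrig₂ g) : IsTrig₂ fun α θ => f α θ - g α θ := by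
  have e : (fun α θ => f α θ - g α θ) = fun α θ => f α θ + -g α θ := by funext α θ; ring
  rw [e]; exact hf.add hg.neg

/-- Trigonometric coefficient functions are smooth in `θ`. [folklore] -/
theorem contDiff {f : ℝ → ℝ → ℝ} (h : IsTrig₂ f) (α : ℝ) (n : ℕ) : ContDiff ℝ n (f α) := by
  induction h with
  | const c => exact contDiff_const
  | alpha => exact contDiff_const
  | sin => exact Real.contDiff_sin
  | cos => exact Real.contDiff_cos
  | add _ _ ihf ihg => exact ihf.add ihg
  | mul _ _ ihf ihg => exact ihf.mul ihg

/-- Trigonometric coefficient functions are differentiable in `θ`. [folklore] -/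
theorem differentiableAt {f : ℝ → ℝ → ℝ} (h : IsTrig₂ f) (α θ : ℝ) : DifferentiableAt ℝ (f α) θ :=
  ((h.contDiff α 1).differentiable (by simp)) θ

/-- **Uniform bound**: `|f(α, θ)| ≤ C` for `0 ≤ α ≤ 1` and all `θ`. [folklore] -/
theorem bounded {f : ℝ → ℝ → ℝ} (h : IsTrig₂ f) : ∃ C, 0 ≤ C ∧ ∀ α ∈ Icc (0 : ℝ) 1, ∀ θ, |f α θ| ≤ C := by
  induction h with
  | const c => exact ⟨|c|, abs_nonneg _, fun _ _ _ => le_rfl⟩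
  | alpha => exact ⟨1, zero_le_one, fun α hα _ => by rw [abs_of_nonneg hα.1]; exact hα.2⟩
  | sin => exact ⟨1, zero_le_one, fun _ _ θ => Real.abs_sin_le_one θ⟩
  | cos => exact ⟨1, zero_le_one, fun _ _ θ => Real.abs_cos_le_one θ⟩
  | add _ _ ihf ihg =>
    obtain ⟨C₁, h₁, hf⟩ := ihf
    obtain ⟨C₂, h₂, hg⟩ := ihg
    exact ⟨C₁ + C₂, by positivity, fun α hα θ => (abs_add_le _ _).trans (add_le_add (hf α hα θ) (hg α hα θ))⟩
  | mul _ _ ihf ihg =>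
    obtain ⟨C₁, h₁, hf⟩ := ihf
    obtain ⟨C₂, h₂, hg⟩ := ihg
    refine ⟨C₁ * C₂, by positivity, fun α hα θ => ?_⟩
    rw [abs_mul]
    exact mul_le_mul (hf α hα θ) (hg α hα θ) (abs_nonneg _) h₁

/-- **Closure under `D_θ = sin(2θ)∂_θ`**: `D_θf(α, ·)` is again a trigonometric coefficient
function. [folklore] -/
theorem hasDθ₁ {f : ℝ → ℝ → ℝ} (h : IsTrig₂ f) : ∃ g, IsTrig₂ g ∧ ∀ α θ, Dθ₁ (f α) θ = g α θ := by
  induction h with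
  | const c =>
    refine ⟨fun _ _ => 0, const 0, fun α θ => ?_⟩
    simp [Dθ₁_apply]
  | alpha =>
    refine ⟨fun _ _ => 0, const 0, fun α θ => ?_⟩
    simp [Dθ₁_apply]
  | sin =>
    refine ⟨fun _ θ => 2 * Real.sin θ * Real.cos θ * Real.cos θ, ((sin.const_mul 2).mul cos).mul cos,
      fun α θ => ?_⟩
    rw [Dθ₁_apply, Real.deriv_sin, Real.sin_two_mul]
  | cos =>
    refine ⟨fun _ θ => -(2 * Real.sin θ * Real.cos θ * Real.sin θ), (((sin.const_mul 2).mul cos).mul sin).neg,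
      fun α θ => ?_⟩
    rw [Dθ₁_apply, Real.deriv_cos, Real.sin_two_mul]
    simp
  | @add f g hf hg ihf ihg =>
    obtain ⟨f', hf', ef⟩ := ihf
    obtain ⟨g', hg', eg⟩ := ihg
    refine ⟨fun α θ => f' α θ + g' α θ, hf'.add hg', fun α θ => ?_⟩
    show Real.sin (2 * θ) * deriv (fun θ => f α θ + g α θ) θ = f' α θ + g' α θ
    rw [deriv_fun_add (hf.differentiableAt α θ) (hg.differentiableAt α θ), ← ef, ← eg, Dθ₁_apply, Dθ₁_apply]
    ring
  | @mul f g hf hg ihf ihg =>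
    obtain ⟨f', hf', ef⟩ := ihf
    obtain ⟨g', hg', eg⟩ := ihg
    refine ⟨fun α θ => f' α θ * g α θ + f α θ * g' α θ, (hf'.mul hg).add (hf.mul hg'), fun α θ => ?_⟩
    show Real.sin (2 * θ) * deriv (fun θ => f α θ * g α θ) θ = f' α θ * g α θ + f α θ * g' α θ
    rw [deriv_fun_mul (hf.differentiableAt α θ) (hg.differentiableAt α θ), ← ef, ← eg, Dθ₁_apply, Dθ₁_apply]
    ring

end IsTrig₂

/-! ### The iterated angular derivatives of `Γ` -/

/-- `D_θ` only sees a neighbourhood: functions that agree on the open quarter have the same `D_θ`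
there. [folklore] -/
theorem Dθ₁_congr_Ioo {f g : ℝ → ℝ} (h : ∀ θ ∈ Ioo 0 (π / 2), f θ = g θ) {θ : ℝ} (hθ : θ ∈ Ioo 0 (π / 2)) :
    Dθ₁ f θ = Dθ₁ g θ := by
  have hev : f =ᶠ[𝓝 θ] g := Filter.eventuallyEq_of_mem (isOpen_Ioo.mem_nhds hθ) h
  rw [Dθ₁_apply, Dθ₁_apply, hev.deriv_eq]

/-- **`D_θ^{i+1}Γ_α = α·U_i(α,θ)·Γ_α` on the open quarter**, with `U_i` a trigonometric coefficient
function (`U_0 = (2/3)(1 − 3sin²θ)`, `U_{i+1} = D_θU_i + αU_iU_0`). [cite: Elgindi2021, §6.1 proof of Proposition 6.5 and §6.3 proof of Proposition 6.13 (pp. 16, 18 of arXiv:1904.04795)] -/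
theorem iterate_Dθ₁_angularWeight (i : ℕ) : ∃ U, IsTrig₂ U ∧ ∀ α, ∀ θ ∈ Ioo 0 (π / 2),
    Dθ₁^[i + 1] (angularWeight α) θ = α * U α θ * angularWeight α θ := by
  -- `U_0`
  set U₀ : ℝ → ℝ → ℝ := fun _ θ => 2 / 3 * (1 + (-3) * (Real.sin θ * Real.sin θ)) with hU₀
  have hT₀ : IsTrig₂ U₀ :=
    ((IsTrig₂.const 1).add ((IsTrig₂.sin.mul IsTrig₂.sin).const_mul (-3))).const_mul (2 / 3)
  have base : ∀ α, ∀ θ ∈ Ioo 0 (π / 2), Dθ₁ (angularWeight α) θ = α * U₀ α θ * angularWeight α θ := by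
    intro α θ hθ
    rw [Dθ₁_apply, sin_two_mul_mul_deriv_angularWeight α hθ, hU₀]
    ring
  induction i with
  | zero => exact ⟨U₀, hT₀, fun α θ hθ => by simpa using base α θ hθ⟩
  | succ i ih =>
    obtain ⟨U, hU, hUeq⟩ := ih
    obtain ⟨U', hU', eU⟩ := hU.hasDθ₁
    refine ⟨fun α θ => U' α θ + α * U α θ * U₀ α θ, hU'.add ((IsTrig₂.alpha.mul hU).mul hT₀), fun α θ hθ => ?_⟩
    rw [Function.iterate_succ_apply']
    -- replace `D_θ^{i+1}Γ` by `α U Γ` near `θ`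
    rw [Dθ₁_congr_Ioo (f := Dθ₁^[i + 1] (angularWeight α)) (g := fun θ => α * U α θ * angularWeight α θ)
      (hUeq α) hθ]
    have hΓ := hasDerivAt_angularWeight α hθ
    have hUd := (hU.differentiableAt α θ).hasDerivAt
    have hd : HasDerivAt (fun θ => α * U α θ * angularWeight α θ)
        (α * deriv (U α) θ * angularWeight α θ + α * U α θ * deriv (angularWeight α) θ) θ := by
      have h := (hUd.const_mul α).mul hΓ
      rw [hΓ.deriv]
      exact h
    rw [Dθ₁_apply, hd.deriv]
    have e1 : Real.sin (2 * θ) * deriv (U α) θ = U' α θ := by rw [← eU, Dθ₁_apply]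
    have e2 : Real.sin (2 * θ) * deriv (angularWeight α) θ = α * U₀ α θ * angularWeight α θ := by
      rw [← Dθ₁_apply]; exact base α θ hθ
    calc Real.sin (2 * θ) * (α * deriv (U α) θ * angularWeight α θ + α * U α θ * deriv (angularWeight α) θ)
        = α * (Real.sin (2 * θ) * deriv (U α) θ) * angularWeight α θ +
            α * U α θ * (Real.sin (2 * θ) * deriv (angularWeight α) θ) := by ring
      _ = α * (U' α θ + α * U α θ * U₀ α θ) * angularWeight α θ := by rw [e1, e2]; ring

/-- **`|D_θ^{i+1}Γ_α| ≤ C_i·α·Γ_α` on the open quarter, uniformly in `0 ≤ α ≤ 1`.** [cite: Elgindi2021, §6 (GammaAssumption 2: "|sin(2θ)∂_θΓ| ≤ 2αΓ") and §6.3 (pp. 15–18 of arXiv:1904.04795)] -/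
theorem abs_iterate_Dθ₁_angularWeight_le (i : ℕ) : ∃ C, 0 ≤ C ∧ ∀ α ∈ Icc (0 : ℝ) 1,
    ∀ θ ∈ Ioo 0 (π / 2), |Dθ₁^[i + 1] (angularWeight α) θ| ≤ C * α * angularWeight α θ := by
  obtain ⟨U, hU, hUeq⟩ := iterate_Dθ₁_angularWeight i
  obtain ⟨C, hC0, hC⟩ := hU.bounded
  refine ⟨C, hC0, fun α hα θ hθ => ?_⟩
  rw [hUeq α θ hθ, abs_mul, abs_mul, abs_of_nonneg hα.1, abs_of_nonneg (angularWeight_nonneg α (Ioo_subset_Icc_self hθ))]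
  have h := hC α hα θ
  have hΓ := angularWeight_nonneg α (Ioo_subset_Icc_self hθ)
  calc α * |U α θ| * angularWeight α θ ≤ α * C * angularWeight α θ := by gcongr; exact hα.1
    _ = C * α * angularWeight α θ := by ring

/-- Uniform boundedness of all `D_θ^iΓ_α` on the open quarter, `0 ≤ α ≤ 1`:
`|D_θ^iΓ_α| ≤ C_i`. [folklore] -/
theorem abs_iterate_Dθ₁_angularWeight_le' (i : ℕ) : ∃ C, 0 ≤ C ∧ ∀ α ∈ Icc (0 : ℝ) 1,
    ∀ θ ∈ Ioo 0 (π / 2), |Dθ₁^[i] (angularWeight α) θ| ≤ C := by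
  cases i with
  | zero =>
    refine ⟨1, zero_le_one, fun α hα θ hθ => ?_⟩
    rw [Function.iterate_zero_apply, abs_of_nonneg (angularWeight_nonneg α (Ioo_subset_Icc_self hθ))]
    exact angularWeight_le_one hα.1 (Ioo_subset_Icc_self hθ)
  | succ i =>
    obtain ⟨C, hC0, hC⟩ := abs_iterate_Dθ₁_angularWeight_le i
    refine ⟨C, hC0, fun α hα θ hθ => (hC α hα θ hθ).trans ?_⟩
    have h1 := angularWeight_le_one hα.1 (Ioo_subset_Icc_self hθ)
    have h0 := angularWeight_nonneg α (Ioo_subset_Icc_self hθ)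
    calc C * α * angularWeight α θ ≤ C * 1 * 1 := by gcongr; exact hα.2
      _ = C := by ring

/-- Continuity of `D_θ^iΓ_α` on the open quarter. [folklore] -/
theorem continuousOn_iterate_Dθ₁_angularWeight (i : ℕ) {α : ℝ} (hα : 0 ≤ α) :
    ContinuousOn (Dθ₁^[i] (angularWeight α)) (Ioo 0 (π / 2)) := by
  cases i with
  | zero => exact (continuous_angularWeight hα).continuousOn
  | succ i =>
    obtain ⟨U, hU, hUeq⟩ := iterate_Dθ₁_angularWeight i
    have hc : Continuous fun θ => α * U α θ * angularWeight α θ :=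
      (continuous_const.mul (hU.contDiff α 0).continuous).mul (continuous_angularWeight hα)
    exact hc.continuousOn.congr fun θ hθ => hUeq α θ hθ

/-! ### The angular integrals, uniformly in `α` -/

/-- **`∫₀^{π/2}(D_θ^iΓ_α)²sin(2θ)^{−η} ≤ C_i`** for `0 ≤ α ≤ 1` (`η = 99/100`; with integrability). [cite: Elgindi2021, §6.2 proof of Proposition 6.9 (the (1−η)^{−1/2} losses) (p. 17 of arXiv:1904.04795)] -/
theorem integral_sq_iterate_Dθ₁_angularWeight_rpow_eta_le (i : ℕ) : ∃ C, 0 ≤ C ∧ ∀ α ∈ Icc (0 : ℝ) 1,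
    IntegrableOn (fun θ => Dθ₁^[i] (angularWeight α) θ ^ 2 * Real.sin (2 * θ) ^ (-eta)) (Ioo 0 (π / 2)) ∧
    ∫ θ in Ioo 0 (π / 2), Dθ₁^[i] (angularWeight α) θ ^ 2 * Real.sin (2 * θ) ^ (-eta) ≤ C := by
  obtain ⟨C, hC0, hC⟩ := abs_iterate_Dθ₁_angularWeight_le' i
  have hr1 : -1 < -eta := by unfold eta; norm_num
  have hr0 : -eta ≤ 0 := by unfold eta; norm_num
  have iM := integrableOn_sin_two_mul_rpow hr1 hr0
  have hIle := integral_sin_two_mul_rpow_le hr1 hr0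
  have h3 : π / (-eta + 1) = 100 * π := by unfold eta; ring
  rw [h3] at hIle
  refine ⟨C ^ 2 * (100 * π), by positivity, fun α hα => ?_⟩
  have hpt : ∀ θ ∈ Ioo 0 (π / 2), Dθ₁^[i] (angularWeight α) θ ^ 2 * Real.sin (2 * θ) ^ (-eta) ≤
      C ^ 2 * Real.sin (2 * θ) ^ (-eta) := by
    intro θ hθ
    have hs : 0 < Real.sin (2 * θ) := Real.sin_pos_of_pos_of_lt_pi (by linarith [hθ.1]) (by linarith [hθ.2])
    have hρ : 0 ≤ Real.sin (2 * θ) ^ (-eta) := Real.rpow_nonneg hs.le _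
    have hb := hC α hα θ hθ
    have : Dθ₁^[i] (angularWeight α) θ ^ 2 ≤ C ^ 2 := by
      rw [← sq_abs]; exact pow_le_pow_left₀ (abs_nonneg _) hb 2
    exact mul_le_mul_of_nonneg_right this hρ
  have hm : AEStronglyMeasurable (fun θ => Dθ₁^[i] (angularWeight α) θ ^ 2 * Real.sin (2 * θ) ^ (-eta))
      (volume.restrict (Ioo 0 (π / 2))) := by
    refine ContinuousOn.aestronglyMeasurable ?_ measurableSet_Ioo
    refine ((continuousOn_iterate_Dθ₁_angularWeight i hα.1).pow 2).mul ?_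
    exact (contDiffOn_sin_two_mul_rpow (-eta)).continuousOn
  have hint : IntegrableOn (fun θ => Dθ₁^[i] (angularWeight α) θ ^ 2 * Real.sin (2 * θ) ^ (-eta)) (Ioo 0 (π / 2)) := by
    refine Integrable.mono' (iM.const_mul (C ^ 2)) hm ?_
    rw [ae_restrict_iff' measurableSet_Ioo]
    refine Filter.Eventually.of_forall fun θ hθ => ?_
    have hs : 0 < Real.sin (2 * θ) := Real.sin_pos_of_pos_of_lt_pi (by linarith [hθ.1]) (by linarith [hθ.2])
    rw [Real.norm_eq_abs, abs_of_nonneg (mul_nonneg (sq_nonneg _) (Real.rpow_nonneg hs.le _))]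
    exact hpt θ hθ
  refine ⟨hint, ?_⟩
  calc ∫ θ in Ioo 0 (π / 2), Dθ₁^[i] (angularWeight α) θ ^ 2 * Real.sin (2 * θ) ^ (-eta)
      ≤ ∫ θ in Ioo 0 (π / 2), C ^ 2 * Real.sin (2 * θ) ^ (-eta) :=
        setIntegral_mono_on hint (iM.const_mul _) measurableSet_Ioo hpt
    _ = C ^ 2 * ∫ θ in Ioo 0 (π / 2), Real.sin (2 * θ) ^ (-eta) := integral_const_mul _ _
    _ ≤ C ^ 2 * (100 * π) := mul_le_mul_of_nonneg_left hIle (sq_nonneg _)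

/-- **`∫₀^{π/2}(D_θ^iΓ_α)² ≤ C_i`** for `0 ≤ α ≤ 1` (with integrability). [folklore] -/
theorem integral_sq_iterate_Dθ₁_angularWeight_le (i : ℕ) : ∃ C, 0 ≤ C ∧ ∀ α ∈ Icc (0 : ℝ) 1,
    IntegrableOn (fun θ => Dθ₁^[i] (angularWeight α) θ ^ 2) (Ioo 0 (π / 2)) ∧
    ∫ θ in Ioo 0 (π / 2), Dθ₁^[i] (angularWeight α) θ ^ 2 ≤ C := by
  obtain ⟨C, hC0, hC⟩ := abs_iterate_Dθ₁_angularWeight_le' i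
  refine ⟨C ^ 2 * (π / 2), by positivity, fun α hα => ?_⟩
  have hpt : ∀ θ ∈ Ioo 0 (π / 2), Dθ₁^[i] (angularWeight α) θ ^ 2 ≤ C ^ 2 := by
    intro θ hθ
    rw [← sq_abs]; exact pow_le_pow_left₀ (abs_nonneg _) (hC α hα θ hθ) 2
  have hm : AEStronglyMeasurable (fun θ => Dθ₁^[i] (angularWeight α) θ ^ 2) (volume.restrict (Ioo 0 (π / 2))) :=
    ((continuousOn_iterate_Dθ₁_angularWeight i hα.1).pow 2).aestronglyMeasurable measurableSet_Ioo
  have iK : IntegrableOn (fun _ : ℝ => C ^ 2) (Ioo 0 (π / 2)) :=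
    (continuous_const.integrableOn_Icc (a := 0) (b := π / 2)).mono_set Ioo_subset_Icc_self
  have hint : IntegrableOn (fun θ => Dθ₁^[i] (angularWeight α) θ ^ 2) (Ioo 0 (π / 2)) := by
    refine Integrable.mono' iK hm ?_
    rw [ae_restrict_iff' measurableSet_Ioo]
    refine Filter.Eventually.of_forall fun θ hθ => ?_
    rw [Real.norm_eq_abs, abs_of_nonneg (sq_nonneg _)]
    exact hpt θ hθ
  refine ⟨hint, ?_⟩
  calc ∫ θ in Ioo 0 (π / 2), Dθ₁^[i] (angularWeight α) θ ^ 2 ≤ ∫ θ in Ioo 0 (π / 2), C ^ 2 :=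
        setIntegral_mono_on hint iK measurableSet_Ioo hpt
    _ = C ^ 2 * (π / 2) := by
        rw [setIntegral_const, Real.volume_real_Ioo_of_le (by positivity), smul_eq_mul]
        ring

/-- The pointwise Jordan bound behind the singular angular integral: on the open quarter,
`Γ_α²sin(2θ)^{−γ} ≤ ((4/π)θ)^r + ((4/π)(π/2−θ))^r`, `r = 2α/3 − γ`, `0 ≤ α ≤ 1`. [folklore] -/
theorem sq_angularWeight_mul_rpow_le {α : ℝ} (hα : 0 ≤ α) (hα1 : α ≤ 1) {θ : ℝ} (hθ : θ ∈ Ioo 0 (π / 2)) :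
    angularWeight α θ ^ 2 * Real.sin (2 * θ) ^ (-gammaExp α) ≤
      (4 / π * θ) ^ (2 * α / 3 - gammaExp α) + (4 / π * (π / 2 - θ)) ^ (2 * α / 3 - gammaExp α) := by
  set r : ℝ := 2 * α / 3 - gammaExp α with hr
  have hr0 : r ≤ 0 := by simp only [hr, gammaExp]; linarith
  set s : ℝ := Real.sin (2 * θ) with hs
  have hspos : 0 < s := Real.sin_pos_of_pos_of_lt_pi (by linarith [hθ.1]) (by linarith [hθ.2])
  have hθ' : θ ∈ Icc 0 (π / 2) := Ioo_subset_Icc_self hθ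
  set x : ℝ := Real.sin θ * Real.cos θ ^ 2 with hx
  have hx0 : 0 ≤ x := sin_mul_cos_sq_nonneg hθ'
  have hxs : x ≤ s := sin_mul_cos_sq_le_sin_two_mul hθ'
  have h2 : angularWeight α θ ^ 2 ≤ s ^ (2 * α / 3) := by
    have e : angularWeight α θ ^ 2 = x ^ (2 * α / 3) := by
      rw [hx]
      unfold angularWeight
      rw [← Real.rpow_two, ← Real.rpow_mul (sin_mul_cos_sq_nonneg hθ')]
      ring_nf
    rw [e]
    exact Real.rpow_le_rpow hx0 hxs (by positivity)
  have h3 : s ^ (2 * α / 3) * s ^ (-gammaExp α) = s ^ r := by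
    rw [← Real.rpow_add hspos, hr]
    ring_nf
  have hJ : s ^ r ≤ (4 / π * θ) ^ r + (4 / π * (π / 2 - θ)) ^ r := by
    have n1 : 0 ≤ (4 / π * θ) ^ r := Real.rpow_nonneg (by have := hθ.1; positivity) _
    have n2 : 0 ≤ (4 / π * (π / 2 - θ)) ^ r := Real.rpow_nonneg (by
      have : 0 < π / 2 - θ := by linarith [hθ.2]
      positivity) _
    rcases le_or_gt θ (π / 4) with hle | hgt
    · have hj : 2 / π * (2 * θ) ≤ Real.sin (2 * θ) :=
        Real.mul_le_sin (by linarith [hθ.1]) (by linarith)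
      have hpos : 0 < 4 / π * θ := by have := hθ.1; positivity
      have : s ^ r ≤ (4 / π * θ) ^ r :=
        Real.rpow_le_rpow_of_nonpos hpos (by rw [hs]; convert hj using 1; ring) hr0
      linarith
    · have hj : 2 / π * (π - 2 * θ) ≤ Real.sin (π - 2 * θ) :=
        Real.mul_le_sin (by linarith [hθ.2]) (by linarith)
      rw [Real.sin_pi_sub] at hj
      have hpos : 0 < 4 / π * (π / 2 - θ) := by
        have : 0 < π / 2 - θ := by linarith [hθ.2]
        positivity
      have : s ^ r ≤ (4 / π * (π / 2 - θ)) ^ r :=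
        Real.rpow_le_rpow_of_nonpos hpos (by rw [hs]; convert hj using 1; ring) hr0
      linarith
  have hsγ : 0 ≤ s ^ (-gammaExp α) := Real.rpow_nonneg hspos.le _
  calc angularWeight α θ ^ 2 * Real.sin (2 * θ) ^ (-gammaExp α) ≤ s ^ (2 * α / 3) * s ^ (-gammaExp α) :=
        mul_le_mul_of_nonneg_right h2 hsγ
    _ = s ^ r := h3
    _ ≤ _ := hJ

/-- **The singular angular integral: `∫₀^{π/2}(D_θ^{i+1}Γ_α)²sin(2θ)^{−γ} ≤ C_i·α`** for
`0 < α ≤ 1`, `γ = 1 + α/10` (`(D_θ^{i+1}Γ)² ≤ C²α²Γ²`, `∫Γ²sin^{−γ} ≤ 30π/(17α)`; with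
integrability). [cite: Elgindi2021, §6.1 proof of Proposition 6.5 ("the second term comes from `D_θΓ ≈ αΓ`") and §6.3 (pp. 16, 18 of arXiv:1904.04795)] -/
theorem integral_sq_iterate_Dθ₁_angularWeight_rpow_gamma_le (i : ℕ) : ∃ C, 0 ≤ C ∧ ∀ α ∈ Ioc (0 : ℝ) 1,
    IntegrableOn (fun θ => Dθ₁^[i + 1] (angularWeight α) θ ^ 2 * Real.sin (2 * θ) ^ (-gammaExp α))
      (Ioo 0 (π / 2)) ∧
    ∫ θ in Ioo 0 (π / 2), Dθ₁^[i + 1] (angularWeight α) θ ^ 2 * Real.sin (2 * θ) ^ (-gammaExp α) ≤ C * α := by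
  obtain ⟨C, hC0, hC⟩ := abs_iterate_Dθ₁_angularWeight_le i
  refine ⟨C ^ 2 * (30 * π / 17), by positivity, fun α hα => ?_⟩
  have hα0 : 0 < α := hα.1
  have hα' : α ∈ Icc (0 : ℝ) 1 := ⟨hα.1.le, hα.2⟩
  have hα1 : α ≤ 1 := hα.2
  have hαne : α ≠ 0 := hα0.ne'
  set r : ℝ := 2 * α / 3 - gammaExp α with hr
  have hr1 : -1 < r := by simp only [hr, gammaExp]; linarith
  have hr0 : r ≤ 0 := by simp only [hr, gammaExp]; linarith
  have hre : r + 1 = 17 * α / 30 := by simp only [hr, gammaExp]; ring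
  set M : ℝ → ℝ := fun θ => C ^ 2 * α ^ 2 * ((4 / π * θ) ^ r + (4 / π * (π / 2 - θ)) ^ r) with hM
  have iM : IntegrableOn M (Ioo 0 (π / 2)) :=
    ((integrableOn_const_mul_rpow hr1).add (integrableOn_const_mul_sub_rpow hr1)).const_mul _
  have hpt : ∀ θ ∈ Ioo 0 (π / 2),
      Dθ₁^[i + 1] (angularWeight α) θ ^ 2 * Real.sin (2 * θ) ^ (-gammaExp α) ≤ M θ := by
    intro θ hθ
    have hs : 0 < Real.sin (2 * θ) := Real.sin_pos_of_pos_of_lt_pi (by linarith [hθ.1]) (by linarith [hθ.2])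
    have hρ : 0 ≤ Real.sin (2 * θ) ^ (-gammaExp α) := Real.rpow_nonneg hs.le _
    have hb := hC α hα' θ hθ
    have h1 : Dθ₁^[i + 1] (angularWeight α) θ ^ 2 ≤ (C * α * angularWeight α θ) ^ 2 := by
      rw [← sq_abs]; exact pow_le_pow_left₀ (abs_nonneg _) hb 2
    have h2 := sq_angularWeight_mul_rpow_le hα.1.le hα.2 hθ
    calc Dθ₁^[i + 1] (angularWeight α) θ ^ 2 * Real.sin (2 * θ) ^ (-gammaExp α)
        ≤ (C * α * angularWeight α θ) ^ 2 * Real.sin (2 * θ) ^ (-gammaExp α) := mul_le_mul_of_nonneg_right h1 hρ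
      _ = C ^ 2 * α ^ 2 * (angularWeight α θ ^ 2 * Real.sin (2 * θ) ^ (-gammaExp α)) := by ring
      _ ≤ C ^ 2 * α ^ 2 * ((4 / π * θ) ^ r + (4 / π * (π / 2 - θ)) ^ r) :=
          mul_le_mul_of_nonneg_left h2 (by positivity)
  have hm : AEStronglyMeasurable
      (fun θ => Dθ₁^[i + 1] (angularWeight α) θ ^ 2 * Real.sin (2 * θ) ^ (-gammaExp α))
      (volume.restrict (Ioo 0 (π / 2))) := by
    refine ContinuousOn.aestronglyMeasurable ?_ measurableSet_Ioo
    refine ((continuousOn_iterate_Dθ₁_angularWeight (i + 1) hα.1.le).pow 2).mul ?_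
    exact (contDiffOn_sin_two_mul_rpow (-gammaExp α)).continuousOn
  have hint : IntegrableOn
      (fun θ => Dθ₁^[i + 1] (angularWeight α) θ ^ 2 * Real.sin (2 * θ) ^ (-gammaExp α)) (Ioo 0 (π / 2)) := by
    refine Integrable.mono' iM hm ?_
    rw [ae_restrict_iff' measurableSet_Ioo]
    refine Filter.Eventually.of_forall fun θ hθ => ?_
    have hs : 0 < Real.sin (2 * θ) := Real.sin_pos_of_pos_of_lt_pi (by linarith [hθ.1]) (by linarith [hθ.2])
    rw [Real.norm_eq_abs, abs_of_nonneg (mul_nonneg (sq_nonneg _) (Real.rpow_nonneg hs.le _))]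
    exact hpt θ hθ
  refine ⟨hint, ?_⟩
  have hIM : ∫ θ in Ioo 0 (π / 2), M θ = C ^ 2 * α ^ 2 * (2 * (2 ^ r * (π / 2) / (r + 1))) := by
    simp only [hM]
    rw [integral_const_mul, integral_add (integrableOn_const_mul_rpow hr1) (integrableOn_const_mul_sub_rpow hr1),
      ← integral_Ioc_eq_integral_Ioo, ← intervalIntegral.integral_of_le (by positivity : (0 : ℝ) ≤ π / 2),
      ← integral_Ioc_eq_integral_Ioo, ← intervalIntegral.integral_of_le (by positivity : (0 : ℝ) ≤ π / 2),
      integral_const_mul_rpow hr1, integral_const_mul_sub_rpow hr1]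
    ring
  have h2r : (2 : ℝ) ^ r ≤ 1 := Real.rpow_le_one_of_one_le_of_nonpos (by norm_num) hr0
  have hval : C ^ 2 * α ^ 2 * (2 * (2 ^ r * (π / 2) / (r + 1))) = C ^ 2 * (30 * π / 17) * α * 2 ^ r := by
    rw [hre]
    field_simp
  calc ∫ θ in Ioo 0 (π / 2), Dθ₁^[i + 1] (angularWeight α) θ ^ 2 * Real.sin (2 * θ) ^ (-gammaExp α)
      ≤ ∫ θ in Ioo 0 (π / 2), M θ := setIntegral_mono_on hint iM measurableSet_Ioo hpt
    _ = C ^ 2 * α ^ 2 * (2 * (2 ^ r * (π / 2) / (r + 1))) := hIM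
    _ = C ^ 2 * (30 * π / 17) * α * 2 ^ r := hval
    _ ≤ C ^ 2 * (30 * π / 17) * α * 1 := by gcongr
    _ = C ^ 2 * (30 * π / 17) * α := mul_one _

end Elgindi

end Literature.Analysis.FluidPDE
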